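import Summits.AtomisticToContinuum.HydrodynamicLimit.Theses.BGEndpointRigidity
import Literature.Barriers.AtomisticToContinuum.HighMomentumCutoff

/-!
# Strategist sketch for the crux `LanfordEnvelopeR` (stmt-AtomisticToContinuum-13677)

Typed records accompanying `STRATEGY-CENSUS.md` (crux-strategist, 2026-08-17).  Nothing here is a
line or a stub; the crux decl is untouched.  Contents:

* §0 the crux's own objects (`evolvedMarginal`, `EnvelopeOn`) and `lanfordEnvelopeR_iff` (by `Iff.rfl`);
* §1 NEGATION — `OrderOneWitness`, the exact shape a refuting witness at order `s = 1` must have, with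
  `not_lanfordEnvelopeR_of_orderOneWitness` (proved): the Guderley focusing hot spot of the census §5 is a
  (physical, uncertified) instance — `s = 1`, `t = t*` the focusing time, `N ≥ N*(β, C)`;
* §2 WEAKEST UNKNOWN CONSEQUENCE — `ExpVelocityMomentBoundFor` (Nachtergaele–Yau II.1, profile-wise) with
  `highMomentumCutoff_iff` (by `Iff.rfl`) and the typed bridge `ExpMomentBridge` (crux ⇒ cutoff below its σ₀;
  true modulo exchangeability of the evolved law, item `FlowMarginalSymmetry`; not proved here);
* §3 STRENGTHEN/RETYPE record for the TENURE planner — `LanfordEnvelopeRGuarded`, the pre-shock, in-band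
  weakening of K3 in the frame of the route's own target `RelEntropyVanishingInBand` / glue `GronwallBGInBand`,
  with `guarded_of_lanfordEnvelopeR` (proved: it IS a weakening, hence a legitimate 1:1 restate target), and
  the S⁺ candidates of census §3 (`PropagationStep`, `LiouvilleDomination`) typed so their defect is visible.
-/

noncomputable section

open MeasureTheory Filter Set
open scoped ENNReal Topology

namespace Summit.AtomisticToContinuum.HydrodynamicLimit.Cruxes.LanfordEnvelopeR.Strategist

open Literature.MathematicalPhysics.KineticTheory Literature.Analysis.FluidPDE
open Summit.AtomisticToContinuum.HydrodynamicLimit.Theses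

/-! ## §0 Objects -/

/-- The `s`-particle volume-marginal of the evolved, domain-cut local Gibbs density at time `t` — verbatim the
term bounded in the crux (indicator of `hardSphereDomain` INSIDE `nthMarginal`, the repair of stmt-11470). -/
def evolvedMarginal (σ : ℝ) (a₀ : T3 → ℝ) (u₀ : T3 → V3) (θ₀ : T3 → ℝ) (N : ℕ)
    (Φ : HardSphereFlow (Torus.geometry (Fin 3)) (hsDiameter σ N) (N + 1)) (t : ℝ) (s : ℕ) :
    Config s (Fin 3) T3 → ℝ :=
  nthMarginal (N + 1) s
    ((hardSphereDomain (Torus.geometry (Fin 3)) (N + 1) (hsDiameter σ N)).indicator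
      (hsTransport Φ t (canonicalDensity (Torus.geometry (Fin 3)) (hsDiameter σ N) (N + 1)
        (localGibbsProfile a₀ u₀ θ₀))))

/-- The Gaussian envelope with constants `(β, C)` on `[0, t]`: all `N`, all flows, all orders, a.e. -/
def EnvelopeOn (σ : ℝ) (a₀ : T3 → ℝ) (u₀ : T3 → V3) (θ₀ : T3 → ℝ) (t β C : ℝ) : Prop :=
  ∀ (N : ℕ) (Φ : HardSphereFlow (Torus.geometry (Fin 3)) (hsDiameter σ N) (N + 1)) (s : ℕ),
    ∀ r ∈ Icc 0 t, ∀ᵐ Zs : Config s (Fin 3) T3,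
      |evolvedMarginal σ a₀ u₀ θ₀ N Φ r s Zs| ≤ C ^ s * Real.exp (-(β * configEnergy Zs))

/-- The crux, re-read through `EnvelopeOn` (definitional). -/
theorem lanfordEnvelopeR_iff : BGEndpointRigidity.LanfordEnvelopeR ↔
    ∀ (a₀ θ₀ : T3 → ℝ) (u₀ : T3 → V3), Continuous a₀ → Continuous θ₀ → Continuous u₀ →
      (∀ x, 0 < a₀ x) → (∀ x, 0 < θ₀ x) → ∃ σ₀ : ℝ, 0 < σ₀ ∧ ∀ σ : ℝ, 0 < σ → σ < σ₀ →
        ∀ T : ℝ, 0 < T → ∃ β C : ℝ, 0 < β ∧ EnvelopeOn σ a₀ u₀ θ₀ T β C :=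
  Iff.rfl

/-! ## §1 Negation: the shape of a refuting witness at order one -/

/-- **Order-one witness shape.** One continuous positive profile triple such that for arbitrarily small `σ`
there is a horizon `T` beyond which NO constants `(β, C)` bound the one-particle evolved marginal for all
`N`: the census's Guderley hot spot (converging shock from continuous spherically symmetric inward data;
bounded density, focal temperature `θ_peak ≍ (σ² N^{1/3})^{2(1-α)/α} → ∞` cut off only at the mean free path)
is the physical instance — `t` = focusing time, `N ≥ N*(β, C)`.  Certifying it needs N-uniform LOWER bounds
on the focal temperature of the deterministic gas (post-shock hydrodynamics of the particle system). -/
def OrderOneWitness : Prop :=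
  ∃ (a₀ θ₀ : T3 → ℝ) (u₀ : T3 → V3), Continuous a₀ ∧ Continuous θ₀ ∧ Continuous u₀ ∧
    (∀ x, 0 < a₀ x) ∧ (∀ x, 0 < θ₀ x) ∧ ∀ σ₀ : ℝ, 0 < σ₀ → ∃ σ : ℝ, 0 < σ ∧ σ < σ₀ ∧
      ∃ T : ℝ, 0 < T ∧ ∀ β C : ℝ, 0 < β →
        ∃ (N : ℕ) (Φ : HardSphereFlow (Torus.geometry (Fin 3)) (hsDiameter σ N) (N + 1)),
          ∃ t ∈ Icc 0 T, ¬ ∀ᵐ z : Config 1 (Fin 3) T3,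
            |evolvedMarginal σ a₀ u₀ θ₀ N Φ t 1 z| ≤ C ^ 1 * Real.exp (-(β * configEnergy z))

/-- An order-one witness refutes the crux (bookkeeping; the converse direction of `push_neg` restricted to
`s = 1`). -/
theorem not_lanfordEnvelopeR_of_orderOneWitness (h : OrderOneWitness) :
    ¬ BGEndpointRigidity.LanfordEnvelopeR := by
  rintro hL
  obtain ⟨a₀, θ₀, u₀, ha, hθ, hu, ha0, hθ0, H⟩ := h
  obtain ⟨σ₀, hσ₀, HL⟩ := hL a₀ θ₀ u₀ ha hθ hu ha0 hθ0
  obtain ⟨σ, hσ, hσlt, T, hT, HW⟩ := H σ₀ hσ₀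
  obtain ⟨β, C, hβ, HE⟩ := HL σ hσ hσlt T hT
  obtain ⟨N, Φ, t, ht, hnot⟩ := HW β C hβ
  exact hnot (HE N Φ 1 t ht)

/-! ## §2 Weakest unknown consequence: Nachtergaele–Yau's high-momentum cutoff, profile-wise -/

/-- **Profile-wise high-momentum cutoff on `[0, T]` at reduced density `σ`** (NY 2003 Assumption II.1 in the
tree's transcription `Literature.Barriers.AtomisticToContinuum.HighMomentumCutoff`, one profile at a time):
the expected empirical exponential velocity moment of the evolved configuration stays bounded, N-uniformly. -/
def ExpVelocityMomentBoundFor (σ : ℝ) (a₀ : T3 → ℝ) (u₀ : T3 → V3) (θ₀ : T3 → ℝ) (T : ℝ) : Prop :=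
  ∀ Φ : (N : ℕ) → HardSphereFlow (Torus.geometry (Fin 3)) (hsDiameter σ N) (N + 1),
    ∃ c : ℝ, 0 < c ∧ ∃ C : ℝ≥0∞, C < ∞ ∧ ∀ N : ℕ, ∀ t ∈ Icc 0 T,
      ∫⁻ z, Literature.Barriers.AtomisticToContinuum.expVelocityMoment c ((Φ N).flow t z)
        ∂(localGibbsLaw σ a₀ u₀ θ₀ N (Φ N)) ≤ C

/-- The barrier's open input is exactly the profile-wise cutoff for all profiles and horizons (definitional). -/
theorem highMomentumCutoff_iff (σ : ℝ) :
    Literature.Barriers.AtomisticToContinuum.HighMomentumCutoff σ ↔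
      ∀ (a₀ θ₀ : T3 → ℝ) (u₀ : T3 → V3), Continuous a₀ → Continuous θ₀ → Continuous u₀ →
        (∀ x, 0 < a₀ x) → (∀ x, 0 < θ₀ x) → ∀ T : ℝ, 0 < T → ExpVelocityMomentBoundFor σ a₀ u₀ θ₀ T :=
  Iff.rfl

/-- **The bridge (typed, not proved here).** The crux at order `s = 1` gives, below its `σ₀`, the profile-wise
cutoff with any `c < β/2`: `∫ (N+1)⁻¹ Σᵢ e^{c|vᵢ(t)|²} dλ = ∫ f⁽¹⁾(t,x,v) e^{c|v|²} ≤ C (π/(β/2 − c))^{3/2}` — using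
that the evolved law is `𝟙_D (W_N ∘ Φ_{-t}) dz` (`HardSphereFlow.lawAt_withDensity`, Liouville) and is
EXCHANGEABLE (item `FlowMarginalSymmetry`, stmt-AtomisticToContinuum-12359's sibling; not an axiom of
`HardSphereFlow`), so every one-particle marginal is the first one.  Value: any N-uniform failure of Gaussian
velocity moments along a local-Gibbs evolution refutes the crux; and the crux sits ABOVE the input that has had
"no proof even in the classical case" since 1993/2003. -/
def ExpMomentBridge : Prop :=
  BGEndpointRigidity.LanfordEnvelopeR →
    ∀ (a₀ θ₀ : T3 → ℝ) (u₀ : T3 → V3), Continuous a₀ → Continuous θ₀ → Continuous u₀ →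
      (∀ x, 0 < a₀ x) → (∀ x, 0 < θ₀ x) → ∃ σ₀ : ℝ, 0 < σ₀ ∧ ∀ σ : ℝ, 0 < σ → σ < σ₀ →
        ∀ T : ℝ, 0 < T → ExpVelocityMomentBoundFor σ a₀ u₀ θ₀ T

/-! ## §3 Strengthen / retype records -/

/-- **S⁺₁ — loss-free propagation over a window of length `τ` (the only form that would make induction in time
close).** TRUE for a Lanford window `τ = c(β, C, σ)(N+1)^{-1/3}` (vendored continuity estimates) with output
constant `2C`, not `C`; as typed (N-independent `τ`, same constants) it is exactly the open heart: `⌈T/τ⌉`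
iterations with `C ↦ 2C` give `2^{⌈T/τ⌉ s}`, and an N-dependent `τ` gives `2^{T N^{1/3} s}`. -/
def PropagationStep (σ : ℝ) (a₀ : T3 → ℝ) (u₀ : T3 → V3) (θ₀ : T3 → ℝ) (τ : ℝ) : Prop :=
  ∀ t β C : ℝ, 0 ≤ t → 0 < β → EnvelopeOn σ a₀ u₀ θ₀ t β C → EnvelopeOn σ a₀ u₀ θ₀ (t + τ) β C

/-- Induction over windows closes trivially from `PropagationStep` — which is why S⁺₁ buys nothing: all the
content moved into the step. -/
theorem envelopeOn_of_propagationStep {σ : ℝ} {a₀ : T3 → ℝ} {u₀ : T3 → V3} {θ₀ : T3 → ℝ} {τ β C : ℝ}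
    (hτ : 0 < τ) (hβ : 0 < β) (hstep : PropagationStep σ a₀ u₀ θ₀ τ)
    (h0 : EnvelopeOn σ a₀ u₀ θ₀ 0 β C) (n : ℕ) : EnvelopeOn σ a₀ u₀ θ₀ (n * τ) β C := by
  induction n with
  | zero => simpa using h0
  | succ n ih =>
    have h := hstep (n * τ) β C (by positivity) hβ ih
    simpa [Nat.cast_succ, add_mul, one_mul] using h

/-- **S⁺₂ — domination at the Liouville level by an invariant density** (`W_N ∘ Φ_{-t} ≤ λ_N · G_N` a.e. with
`G_N` the global Gibbs density of a constant profile): TRUE with `λ_N = K^{N+1}` (energy conservation on good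
orbits + `Φ`-invariance of `G_N`), and this is precisely the crude envelope of the live line's S1; the added
rigidity (invariance ⇒ all times for free) buys nothing at orders `s ≪ N` because `inf λ_N = e^{(N+1) h}`,
`h > 0` the specific relative entropy of the local versus the best global Gibbs profile (non-constant data). -/
def LiouvilleDomination (σ : ℝ) (a₀ : T3 → ℝ) (u₀ : T3 → V3) (θ₀ : T3 → ℝ) (ab θb : ℝ) (ub : V3)
    (lam : ℕ → ℝ) : Prop :=
  ∀ (N : ℕ) (Φ : HardSphereFlow (Torus.geometry (Fin 3)) (hsDiameter σ N) (N + 1)) (t : ℝ),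
    ∀ᵐ z : Config (N + 1) (Fin 3) T3,
      (hardSphereDomain (Torus.geometry (Fin 3)) (N + 1) (hsDiameter σ N)).indicator
          (hsTransport Φ t (canonicalDensity (Torus.geometry (Fin 3)) (hsDiameter σ N) (N + 1)
            (localGibbsProfile a₀ u₀ θ₀))) z ≤
        lam N * canonicalDensity (Torus.geometry (Fin 3)) (hsDiameter σ N) (N + 1)
          (localGibbsProfile (fun _ => ab) (fun _ => ub) (fun _ => θb)) z

/-- **GUARDED K3 — the restate candidate for the TENURE planner** (this seat cannot restate).  The envelope is
asked only where the route consumes it: along a CLASSICAL hard-sphere Euler solution on `[0, T)` obeying the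
conjunct's packing guard, for the flows of the family and times `r ≤ t < T`, with `(β, C)` chosen after `t` —
verbatim the frame of the route's target `RelEntropyVanishingInBand` and glue `GronwallBGInBand`.  Pre-shock
classical evolutions exclude the converging-shock focusing of census §5; the packing guard caps the smooth
implosions (θ ∝ ρ^{2/3} ≤ c(η₀/σ³)^{2/3}).  Still conjecture-grade (L^∞ local equilibrium), but no longer
heuristically false. -/
def LanfordEnvelopeRGuarded : Prop :=
  ∃ η₀ : ℝ, 0 < η₀ ∧ ∀ (a₀ θ₀ : T3 → ℝ) (u₀ : T3 → V3), Continuous a₀ → Continuous θ₀ → Continuous u₀ →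
    (∀ x, 0 < a₀ x) → (∀ x, 0 < θ₀ x) → ∃ σ₀ : ℝ, 0 < σ₀ ∧ ∀ σ : ℝ, 0 < σ → σ < σ₀ →
      ∀ (T : ℝ) (ρ θ : ℝ → T3 → ℝ) (u : ℝ → T3 → V3), IsHardSphereEulerSolution σ T ρ u θ →
        (∀ t' ∈ Ico 0 T, ∀ x, ρ t' x * σ ^ 3 < η₀) →
        ∀ Φ : (N : ℕ) → HardSphereFlow (Torus.geometry (Fin 3)) (hsDiameter σ N) (N + 1),
          TendstoHydroFieldsAt (fun N => localGibbsLaw σ a₀ u₀ θ₀ N (Φ N)) Φ ρ u θ 0 →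
            ∀ t ∈ Ico 0 T, ∃ β C : ℝ, 0 < β ∧
              ∀ (N : ℕ) (s : ℕ), ∀ r ∈ Icc 0 t, ∀ᵐ Zs : Config s (Fin 3) T3,
                |evolvedMarginal σ a₀ u₀ θ₀ N (Φ N) r s Zs| ≤ C ^ s * Real.exp (-(β * configEnergy Zs))

/-- The guarded form is a WEAKENING of the crux (so a 1:1 tenure restate keeps every consumer honest: whatever
`GronwallBGInBand` does with K3 it does along a guarded classical solution at times `< T`). -/
theorem guarded_of_lanfordEnvelopeR (h : BGEndpointRigidity.LanfordEnvelopeR) : LanfordEnvelopeRGuarded := by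
  refine ⟨1, one_pos, fun a₀ θ₀ u₀ ha hθ hu ha0 hθ0 => ?_⟩
  obtain ⟨σ₀, hσ₀, H⟩ := h a₀ θ₀ u₀ ha hθ hu ha0 hθ0
  refine ⟨σ₀, hσ₀, fun σ hσ hσlt T ρ θ u _ _ Φ _ t ht => ?_⟩
  obtain ⟨β, C, hβ, hE⟩ := H σ hσ hσlt (t + 1) (by linarith [ht.1])
  exact ⟨β, C, hβ, fun N s r hr => hE N (Φ N) s r ⟨hr.1, hr.2.trans (by linarith)⟩⟩

end Summit.AtomisticToContinuum.HydrodynamicLimit.Cruxes.LanfordEnvelopeR.Strategist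

end
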